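import Summits.HodgeConjecture.HodgeConjecture.Theorems.Ring2WeilCoverageCMFieldCarrierPresentation
import Summits.HodgeConjecture.HodgeConjecture.Theorems.Ring2WeilCoverageCMFieldCriteria
import Mathlib.FieldTheory.Galois.Basic
import HarnessLib

/-!
# Ring 2 — Weil-type family-coverage census, CM-field rows (X-K): GALOIS CRITERIA on Deligne's quartic
# carriers `E = ℚ[T]/(T⁴ + pT² + q)` from one element — splitting `T⁴ + pT² + q = (T² − η²)(T² − η'²)`,
# `IsGalois`, the automorphism `η ↦ η'`, cyclicity, and imaginary quadratic subfields `ℚ(√-c) ⊂ E`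

HONEST FRAMING: research route conditional on HC_CM; not a corollary; Q11.4-sentence-2 already refuted in dim ≥ 3.

Cell `pub-hodge-ring2`, seat `ring2-b03` (gen 56), census `WEIL-FAMILY-COVERAGE.md` «## b03», open cell (xi′): the
Galois-theoretic inputs of the carrier theorems of part X-J (`Ring2WeilCoverageCMFieldCarrierPresentation`:
`IsGalois ℚ E`, `IsCyclic (E ≃ₐ[ℚ] E)`, an imaginary quadratic CM subfield `K₁ → E`) for a quadratic
`R = S² + pS + q ∈ ℤ[S]` (so `E = cmField R = ℚ(η)`, `η⁴ + pη² + q = 0`, `F = ℚ(η²)`), reduced to IDENTITIES IN `E`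
that the instance file X-L checks by `linear_combination`:

* §1 `cmRoot_quartic` (`η⁴ + pη² + q = 0`), `map_cmPolyQ_of_quadratic`, `cmRoot_ne_zero'`.
* §2 **splitting from one more root.** If `η' ∈ E` satisfies `η'² + η² + p = 0` (i.e. `η'²` is the OTHER root
  of `R`), then `T⁴ + pT² + q = (T − η)(T + η)(T − η')(T + η')` in `E[T]` (`η²η'² = q` from `R(η²) = 0`), so
  `E` is a splitting field of the separable `T⁴ + pT² + q` and **`E/ℚ` is Galois** (`isGalois_of_sq_add`).
* §3 **the automorphism `σ : η ↦ η'`** (`exists_algEquiv_apply_cmRoot`, via `AdjoinRoot.lift` and bijectivity of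
  endomorphisms of a number field) and **cyclicity**: if `η' = u(η)` for a `u ∈ ℚ[T]` with `u(η') = -η`, then
  `σ²(η) = -η ≠ η`, `σ⁴ = 1`, `ord σ = 4 = |Gal(E/ℚ)|`, so **`Gal(E/ℚ)` is cyclic** (`isCyclic_of_sq_add`).
* §4 **imaginary quadratic subfields.** For `c ∈ ℤ`, `c > 0`, Deligne's carrier of the LINEAR `R₁ = S + c` is
  `cmField (X + C c) = ℚ[T]/(T² + c) = ℚ(√-c)`, a CM field of degree `2` (`isCMField_cmField_linear`,
  `finrank_cmField_linear`); an element `i ∈ E` with `i² + c = 0` gives `ℚ(√-c) →+* E`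
  (`exists_ringHom_cmField_linear`).
* §5 `roots_real_neg_of_quadratic` (the roots of `S² + pS + q` are real negative for `p, q > 0`, `4q < p²` — every census
  carrier, so `E` is a CM field by `Deligne1982.isCMField_cmField`), `not_sq_of_eq_prime_mul_sq` (discriminants).
* §6 **the carrier theorems with these inputs discharged**: `carrier_exists_cmEightfold_hodgeConjectureFor_of_twist`
  (cyclic case: data `η'`, `u`) and `carrier_exists_cmEightfold_hodgeConjectureFor_of_sqrt` (biquadratic case: data
  `η'`, `i`, `c`) — on EVERY row `δ ∈ cmNormResidueGroup R` a CM eightfold with the Hodge conjecture in the kernel.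

THEOREMS ONLY: no `def`, no named fact, no `sorry`; `HC_CM` does not occur; the Hodge conjecture enters only through
part X-J (Pohlmann / Hazama cases PROVED in the tree). HONEST COLUMN: as in X-J — named CM members only; the general
member of every row stays OPEN (crux stmt-1076).

## References
* [Deligne1982HodgeCycles] P. Deligne (notes by J. S. Milne), LNM 900 (1982), §4 (presentation `E = ℚ(η)`) and §5 (c).
* [Shimura1998] G. Shimura, *Abelian Varieties with Complex Multiplication and Modular Functions* (1998), §8 Ex. 8.4 (2)
  (the trichotomy biquadratic / cyclic / non-Galois for quartic CM fields).
-/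

noncomputable section

set_option linter.dupNamespace false

namespace Summit.HodgeConjecture.HodgeConjecture.Ring2.WeilCoverageCM

open CategoryTheory CategoryTheory.Limits Polynomial NumberField
open Literature.AlgebraicGeometry Literature.AlgebraicGeometry.Motives Literature.AlgebraicGeometry.HodgeTheory
open Literature.AlgebraicGeometry.ComplexMultiplication Literature.AlgebraicGeometry.Deligne1982
open Literature.AlgebraicGeometry.Milne1999
open Summit.HodgeConjecture.HodgeConjecture.Ring2.Hypotheses (RosatiCompatible)

/-! ## §1 The quartic relation on the carrier -/

section Quartic

variable {p q : ℤ} (R : Polynomial ℤ) (hR : R = X ^ 2 + C p * X + C q)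
include hR

/-- `R(T²) ⊗ S = T⁴ + pT² + q` under any `ℚ → S`. [cite: Deligne1982HodgeCycles, §4 p. 30] -/
theorem map_cmPolyQ_of_quadratic {S : Type*} [CommRing S] (f : ℚ →+* S) :
    (cmPolyQ R).map f = X ^ 4 + C (p : S) * X ^ 2 + C (q : S) := by
  rw [cmPolyQ_eq_of_quadratic hR, Polynomial.map_add, Polynomial.map_add, Polynomial.map_mul, Polynomial.map_pow,
    Polynomial.map_pow, map_X, map_C, map_C, map_intCast f p, map_intCast f q]

/-- `R(T²)(x) = x⁴ + px² + q` under any `ℚ → S`. [cite: Deligne1982HodgeCycles, §4 p. 30] -/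
theorem eval₂_cmPolyQ_of_quadratic {S : Type*} [CommRing S] (f : ℚ →+* S) (x : S) :
    Polynomial.eval₂ f x (cmPolyQ R) = x ^ 4 + (p : S) * x ^ 2 + (q : S) := by
  rw [← Polynomial.eval_map, map_cmPolyQ_of_quadratic R hR]
  simp only [eval_add, eval_mul, eval_pow, eval_X, eval_C]

variable [Fact (Irreducible (cmPolyQ R))]

/-- **`η⁴ + pη² + q = 0`** in `E = ℚ[T]/(T⁴ + pT² + q)`. [cite: Deligne1982HodgeCycles, §4 p. 30] -/
theorem cmRoot_quartic : cmRoot R ^ 4 + (p : cmField R) * cmRoot R ^ 2 + (q : cmField R) = 0 := by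
  rw [← eval₂_cmPolyQ_of_quadratic R hR (AdjoinRoot.of (cmPolyQ R))]
  exact AdjoinRoot.eval₂_root _

/-- `η ≠ 0` (an irreducible quartic is not divisible by `T`). [folklore] -/
theorem cmRoot_ne_zero' : cmRoot R ≠ 0 := by
  intro h
  have hdvd : cmPolyQ R ∣ X := by rw [← AdjoinRoot.mk_eq_zero, AdjoinRoot.mk_X]; exact h
  have hle := Polynomial.natDegree_le_of_dvd hdvd Polynomial.X_ne_zero
  rw [natDegree_cmPolyQ_eq, Polynomial.natDegree_X, hR] at hle
  have : (X ^ 2 + C p * X + C q : Polynomial ℤ).natDegree = 2 := by compute_degree!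
  omega

end Quartic

/-! ## §2 Splitting and `IsGalois` from one more root `η'`, `η'² + η² + p = 0` -/

section Galois

variable {p q : ℤ} (R : Polynomial ℤ) (hR : R = X ^ 2 + C p * X + C q) [Fact (Irreducible (cmPolyQ R))]
include hR

/-- **`T⁴ + pT² + q = (T − η)(T + η)(T − η')(T + η')` in `E[T]`** when `η'² + η² + p = 0` (`η²`, `η'²` are the two
roots of `R`, `η²η'² = q`). [cite: Deligne1982HodgeCycles, §4 p. 30] -/
theorem map_cmPolyQ_eq_prod (t' : cmField R) (h1 : t' ^ 2 + cmRoot R ^ 2 + (p : cmField R) = 0) :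
    (cmPolyQ R).map (algebraMap ℚ (cmField R)) =
      (X - C (cmRoot R)) * (X + C (cmRoot R)) * ((X - C t') * (X + C t')) := by
  have h2 := cmRoot_quartic R hR
  have h1' : C t' ^ 2 + C (cmRoot R) ^ 2 + C (p : cmField R) = 0 := by
    have := congrArg Polynomial.C h1
    simpa only [map_add, map_pow, map_zero] using this
  have h2' : C (cmRoot R) ^ 4 + C (p : cmField R) * C (cmRoot R) ^ 2 + C (q : cmField R) = 0 := by
    have := congrArg Polynomial.C h2
    simpa only [map_add, map_mul, map_pow, map_zero] using this
  rw [map_cmPolyQ_of_quadratic R hR]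
  linear_combination (X ^ 2 - C (cmRoot R) ^ 2) * h1' + h2'

/-- `T⁴ + pT² + q` splits in `E` when `η'² + η² + p = 0` for some `η' ∈ E`. [cite: Deligne1982HodgeCycles, §4 p. 30] -/
theorem splits_map_cmPolyQ (t' : cmField R) (h1 : t' ^ 2 + cmRoot R ^ 2 + (p : cmField R) = 0) :
    ((cmPolyQ R).map (algebraMap ℚ (cmField R))).Splits := by
  rw [map_cmPolyQ_eq_prod R hR t' h1]
  exact ((Splits.X_sub_C _).mul (Splits.X_add_C _)).mul ((Splits.X_sub_C _).mul (Splits.X_add_C _))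

/-- `E` is a splitting field of `T⁴ + pT² + q` over `ℚ` when `η'² + η² + p = 0` for some `η' ∈ E`. [folklore] -/
theorem isSplittingField_cmPolyQ (t' : cmField R) (h1 : t' ^ 2 + cmRoot R ^ 2 + (p : cmField R) = 0) :
    Polynomial.IsSplittingField ℚ (cmField R) (cmPolyQ R) := by
  refine ⟨splits_map_cmPolyQ R hR t' h1, ?_⟩
  refine top_le_iff.1 ?_
  have htop : Algebra.adjoin ℚ ({cmRoot R} : Set (cmField R)) = ⊤ := AdjoinRoot.adjoinRoot_eq_top
  rw [← htop]
  refine Algebra.adjoin_mono ?_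
  rintro x hx
  rw [Set.mem_singleton_iff] at hx
  subst hx
  rw [Polynomial.mem_rootSet]
  refine ⟨(Fact.out : Irreducible (cmPolyQ R)).ne_zero, ?_⟩
  rw [Polynomial.aeval_def, eval₂_cmPolyQ_of_quadratic R hR]
  exact cmRoot_quartic R hR

/-- **`E/ℚ` is Galois** when `η'² + η² + p = 0` for some `η' ∈ E` (splitting field of the separable irreducible
`T⁴ + pT² + q`). [cite: Shimura1998, §8 Ex. 8.4 (2)] -/
theorem isGalois_of_sq_add (t' : cmField R) (h1 : t' ^ 2 + cmRoot R ^ 2 + (p : cmField R) = 0) :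
    IsGalois ℚ (cmField R) := by
  haveI := isSplittingField_cmPolyQ R hR t' h1
  exact IsGalois.of_separable_splitting_field (p := cmPolyQ R) (Fact.out : Irreducible (cmPolyQ R)).separable

end Galois

/-! ## §3 The automorphism `η ↦ η'` and cyclicity -/

section Cyclic

variable {p q : ℤ} (R : Polynomial ℤ) (hR : R = X ^ 2 + C p * X + C q) [Fact (Irreducible (cmPolyQ R))]
include hR

/-- `R(T²)(η') = 0`: `η'` is a root of `T⁴ + pT² + q` too. [cite: Deligne1982HodgeCycles, §4 p. 30] -/
theorem eval₂_cmPolyQ_twist (t' : cmField R) (h1 : t' ^ 2 + cmRoot R ^ 2 + (p : cmField R) = 0) :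
    Polynomial.eval₂ (algebraMap ℚ (cmField R)) t' (cmPolyQ R) = 0 := by
  rw [eval₂_cmPolyQ_of_quadratic R hR]
  have h2 := cmRoot_quartic R hR
  linear_combination (t' ^ 2 - cmRoot R ^ 2) * h1 + h2

/-- **The automorphism `σ : η ↦ η'` of `E/ℚ`.** [cite: Shimura1998, §8 Ex. 8.4 (2)] -/
theorem exists_algEquiv_apply_cmRoot (t' : cmField R) (h1 : t' ^ 2 + cmRoot R ^ 2 + (p : cmField R) = 0) :
    ∃ σ : cmField R ≃ₐ[ℚ] cmField R, σ (cmRoot R) = t' := by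
  let σ₀ : cmField R →+* cmField R :=
    AdjoinRoot.lift (algebraMap ℚ (cmField R)) t' (eval₂_cmPolyQ_twist R hR t' h1)
  have hσ₀ : σ₀ (cmRoot R) = t' := AdjoinRoot.lift_root _
  let σ₁ : cmField R →ₐ[ℚ] cmField R := σ₀.toRatAlgHom
  have hbij : Function.Bijective σ₁ := Algebra.IsAlgebraic.algHom_bijective σ₁
  exact ⟨AlgEquiv.ofBijective σ₁ hbij, hσ₀⟩

omit hR in
/-- An automorphism of `E/ℚ` commutes with evaluation of rational polynomials: `σ(u(x)) = u(σ x)`. [folklore] -/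
theorem algEquiv_aeval (σ : cmField R ≃ₐ[ℚ] cmField R) (u : Polynomial ℚ) (x : cmField R) :
    σ (Polynomial.aeval x u) = Polynomial.aeval (σ x) u :=
  (Polynomial.aeval_algHom_apply σ x u).symm

/-- **`Gal(E/ℚ)` is CYCLIC** (of order `4`) when `η' = u(η) ∈ E` satisfies `η'² + η² + p = 0` and `u(η') = -η`:
`σ : η ↦ η'` has `σ²(η) = -η ≠ η` and `σ⁴ = 1`, so `ord σ = 4 = [E:ℚ] = |Gal(E/ℚ)|`.
[cite: Shimura1998, §8 Ex. 8.4 (2)] -/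
theorem isCyclic_of_sq_add (t' : cmField R) (h1 : t' ^ 2 + cmRoot R ^ 2 + (p : cmField R) = 0)
    (u : Polynomial ℚ) (hu : Polynomial.aeval (cmRoot R) u = t') (h2 : Polynomial.aeval t' u = -cmRoot R) :
    IsCyclic (cmField R ≃ₐ[ℚ] cmField R) := by
  haveI : IsGalois ℚ (cmField R) := isGalois_of_sq_add R hR t' h1
  obtain ⟨σ, hσ⟩ := exists_algEquiv_apply_cmRoot R hR t' h1
  have hσσ : σ (σ (cmRoot R)) = -cmRoot R := by
    rw [hσ, ← hu, algEquiv_aeval R, hσ, h2]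
  have h0 : cmRoot R ≠ 0 := cmRoot_ne_zero' R hR
  have hsq : σ ^ 2 ≠ 1 := by
    intro h
    have := AlgEquiv.congr_fun h (cmRoot R)
    rw [sq, AlgEquiv.mul_apply, hσσ, AlgEquiv.one_apply] at this
    exact h0 (CharZero.neg_eq_self_iff.1 this)
  have h4 : σ ^ 4 = 1 := by
    have key : (σ ^ 4) (cmRoot R) = cmRoot R := by
      rw [show (4 : ℕ) = 2 + 2 by norm_num, pow_add, sq, AlgEquiv.mul_apply, AlgEquiv.mul_apply,
        AlgEquiv.mul_apply, hσσ, map_neg, map_neg, hσσ, neg_neg]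
    have hring : ((σ ^ 4 : cmField R ≃ₐ[ℚ] cmField R) : cmField R →+* cmField R) =
        ((1 : cmField R ≃ₐ[ℚ] cmField R) : cmField R →+* cmField R) :=
      ringHom_ext_cmRoot R (by simpa using key)
    ext x
    exact RingHom.congr_fun hring x
  have hord : orderOf σ = 2 ^ (1 + 1) :=
    orderOf_eq_prime_pow (p := 2) (n := 1) (by simpa using hsq) (by simpa using h4)
  have hcard : Nat.card (cmField R ≃ₐ[ℚ] cmField R) = 4 := by
    rw [IsGalois.card_aut_eq_finrank, finrank_cmField, hR]
    have : (X ^ 2 + C p * X + C q : Polynomial ℤ).natDegree = 2 := by compute_degree!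
    rw [this]
  exact isCyclic_of_orderOf_eq_card σ (by rw [hord, hcard]; norm_num)

end Cyclic

/-! ## §4 Imaginary quadratic fields as Deligne carriers of LINEAR `R₁ = S + c`: `ℚ(√-c) = ℚ[T]/(T² + c)` -/

section Linear

variable (c : ℤ)

/-- `cmPolyQ (S + c) = T² + c`. [cite: Deligne1982HodgeCycles, §4 p. 30] -/
theorem cmPolyQ_linear : cmPolyQ (X + C c) = X ^ 2 + C (c : ℚ) := by
  rw [cmPolyQ, add_comp, X_comp, C_comp, Polynomial.map_add, Polynomial.map_pow, map_X, map_C, eq_intCast]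

/-- `realPolyQ (S + c) = S + c`. [cite: Deligne1982HodgeCycles, §4 p. 30] -/
theorem realPolyQ_linear : realPolyQ (X + C c) = X + C (c : ℚ) := by
  rw [realPolyQ, Polynomial.map_add, map_X, map_C, eq_intCast]

/-- `S + c` is irreducible over `ℚ` (degree one): `F₁ = ℚ`. [folklore] -/
theorem fact_irreducible_realPolyQ_linear : Fact (Irreducible (realPolyQ (X + C c))) := by
  rw [realPolyQ_linear]
  exact ⟨Polynomial.irreducible_of_degree_eq_one (Polynomial.degree_X_add_C _)⟩

/-- `T² + c` is irreducible over `ℚ` for `c > 0` (no rational square is negative). [folklore] -/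
theorem fact_irreducible_cmPolyQ_linear (hc : 0 < c) : Fact (Irreducible (cmPolyQ (X + C c))) := by
  rw [cmPolyQ_linear]
  have h := irreducible_quadratic_of_not_sq (0 : ℚ) (c : ℚ) (fun r hr => by
    have : (0 : ℚ) < c := by exact_mod_cast hc
    nlinarith [sq_nonneg r])
  have h' : Irreducible (X ^ 2 + C (c : ℚ) : Polynomial ℚ) := by
    simpa only [map_zero, zero_mul, add_zero] using h
  exact ⟨h'⟩

/-- The root of `S + c` is `-c`: real and negative for `c > 0`. [folklore] -/
theorem roots_linear (hc : 0 < c) :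
    ∀ s : ℂ, Polynomial.eval₂ (Int.castRingHom ℂ) s (X + C c) = 0 → s.im = 0 ∧ s.re < 0 := by
  intro s hs
  rw [eval₂_add, eval₂_X, eval₂_C, eq_intCast] at hs
  have : s = -(c : ℂ) := by linear_combination hs
  subst this
  refine ⟨by simp, ?_⟩
  have : (0 : ℝ) < c := by exact_mod_cast hc
  simpa using this

/-- **`ℚ(√-c) = cmField (S + c)` is a CM field** (`c > 0`). [cite: Deligne1982HodgeCycles, §4 p. 30] -/
theorem isCMField_cmField_linear (hc : 0 < c) :
    haveI := fact_irreducible_cmPolyQ_linear c hc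
    IsCMField (cmField (X + C c)) := by
  haveI := fact_irreducible_cmPolyQ_linear c hc
  haveI := fact_irreducible_realPolyQ_linear c
  exact isCMField_cmField (roots_linear c hc)

/-- `[ℚ(√-c) : ℚ] = 2`. [folklore] -/
theorem finrank_cmField_linear (hc : 0 < c) :
    haveI := fact_irreducible_cmPolyQ_linear c hc
    Module.finrank ℚ (cmField (X + C c)) = 2 := by
  haveI := fact_irreducible_cmPolyQ_linear c hc
  rw [finrank_cmField, Polynomial.natDegree_X_add_C]

/-- **`ℚ(√-c) → E` from an element `i ∈ E` with `i² + c = 0`.** [folklore] -/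
theorem exists_ringHom_cmField_linear (hc : 0 < c) {S : Type*} [Field S] [CharZero S] (i : S)
    (hi : i ^ 2 + (c : S) = 0) :
    haveI := fact_irreducible_cmPolyQ_linear c hc
    ∃ ψ : cmField (X + C c) →+* S, ψ (cmRoot (X + C c)) = i := by
  haveI := fact_irreducible_cmPolyQ_linear c hc
  refine ⟨AdjoinRoot.lift (algebraMap ℚ S) i ?_, AdjoinRoot.lift_root _⟩
  rw [cmPolyQ_linear, eval₂_add, eval₂_pow, eval₂_X, eval₂_C, map_intCast]
  exact hi

end Linear

/-! ## §5 The roots of the census carriers `S² + pS + q` (`p, q > 0`, `4q < p²`) are real and negative -/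

/-- **The roots of `S² + pS + q` are real and negative** when `p > 0`, `q > 0`, `4q < p²`: for a complex root
`s = x + iy`, the imaginary part gives `y(2x + p) = 0`; `2x + p = 0` would force `y² = q - p²/4 < 0`; so `y = 0` and
`x² + px + q = 0` with `p, q > 0` forces `x < 0`. (Every census carrier: `σ = η²` is totally negative.) [folklore] -/
theorem roots_real_neg_of_quadratic {p q : ℤ} {R : Polynomial ℤ} (hR : R = X ^ 2 + C p * X + C q) (hp : 0 < p)
    (hq : 0 < q) (hd : 4 * q < p ^ 2) :
    ∀ s : ℂ, Polynomial.eval₂ (Int.castRingHom ℂ) s R = 0 → s.im = 0 ∧ s.re < 0 := by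
  intro s hs
  rw [hR, eval₂_add, eval₂_add, eval₂_mul, eval₂_pow, eval₂_X, eval₂_C, eval₂_C, eq_intCast, eq_intCast] at hs
  have hp' : (0 : ℝ) < p := by exact_mod_cast hp
  have hq' : (0 : ℝ) < q := by exact_mod_cast hq
  have hd' : (4 : ℝ) * q < (p : ℝ) ^ 2 := by exact_mod_cast hd
  have hre := congrArg Complex.re hs
  have him := congrArg Complex.im hs
  simp only [sq, Complex.add_re, Complex.mul_re, Complex.intCast_re, Complex.intCast_im, Complex.zero_re,
    Complex.add_im, Complex.mul_im, Complex.zero_im, zero_mul, sub_zero, add_zero] at hre him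
  have hy : s.im * (2 * s.re + p) = 0 := by linear_combination him
  rcases mul_eq_zero.1 hy with h0 | h0
  · refine ⟨h0, ?_⟩
    rw [h0, mul_zero, sub_zero] at hre
    by_contra hx
    push Not at hx
    nlinarith [mul_nonneg hx hp'.le, mul_nonneg hx hx]
  · exfalso
    have hx : s.re = -(p : ℝ) / 2 := by linear_combination h0 / 2
    rw [hx] at hre
    nlinarith [sq_nonneg s.im]

/-- The discriminant `p² - 4q` of a census carrier is a prime times a non-zero square, hence not a rational square.
[folklore] -/
theorem not_sq_of_eq_prime_mul_sq {p q : ℤ} {ℓ : ℕ} (hℓ : ℓ.Prime) {m : ℚ} (hm : m ≠ 0)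
    (h : (p : ℚ) ^ 2 - 4 * q = ℓ * m ^ 2) : ∀ r : ℚ, r ^ 2 ≠ (p : ℚ) ^ 2 - 4 * q := by
  intro r
  rw [h]
  exact rat_sq_ne_prime_mul_sq hℓ hm r

/-! ## §6 The carrier theorems with the Galois inputs discharged by elements of `E` -/

section Carrier

variable {p q : ℤ} (R : Polynomial ℤ) (hR : R = X ^ 2 + C p * X + C q) [Fact (Irreducible (cmPolyQ R))]
  [Fact (Irreducible (realPolyQ R))]
include hR

/-- `R = S² + pS + q` is monic of degree `2`. [folklore] -/
theorem monic_and_natDegree_of_quadratic : R.Monic ∧ R.natDegree = 2 := by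
  subst hR
  exact ⟨by monicity!, by compute_degree!⟩

/-- **CYCLIC quartic carriers: HC at a CM eightfold on EVERY row of the table.** For `R = S² + pS + q` with
`T⁴ + pT² + q` and `R` irreducible over `ℚ` and the roots of `R` real negative, elements `η' = u(η) ∈ E` with
`η'² + η² + p = 0` and `u(η') = -η` (so `Gal(E/ℚ) ≅ C₄`), and EVERY `δ ∈ cmNormResidueGroup R`: a CM eightfold
`A ≅ B⁴`, `B` a SIMPLE CM abelian surface, with a Weil-type `(2,2;2,2)` datum relative to `E`, a Rosati-compatible
polarization class of discriminant `δ`, the Hodge conjecture for `A` (kernel) and `W_E(A) ⊗ ℂ` algebraic.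
[cite: Pohlmann1968, Thm. 1] [cite: Deligne1982HodgeCycles, §5 (c) pp. 38–39] [cite: Shimura1998, §8 Ex. 8.4 (2)] -/
theorem carrier_exists_cmEightfold_hodgeConjectureFor_of_twist
    (hroots : ∀ s : ℂ, Polynomial.eval₂ (Int.castRingHom ℂ) s R = 0 → s.im = 0 ∧ s.re < 0)
    (t' : cmField R) (h1 : t' ^ 2 + cmRoot R ^ 2 + (p : cmField R) = 0)
    (u : Polynomial ℚ) (hu : Polynomial.aeval (cmRoot R) u = t') (h2 : Polynomial.aeval t' u = -cmRoot R)
    (δ : cmNormResidueGroup R) :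
    ∃ (A : AbelianVariety ℂ) (η : A ⟶ A) (h : complexBetti A.X 2) (B : AbelianVariety ℂ),
      Nonempty (A ≅ ⨁ fun _ : Fin 4 => B) ∧ B.IsSimple ∧ B.dim = 2 ∧ IsOfCMType B ∧ A.dim = 8 ∧ IsOfCMType A ∧
      IsWeilTypeCM A η R 2 2 ∧ IsPolarizationClass A.dim A.X h ∧ RosatiCompatible A η h ∧
      HasWeilDiscriminantCM A η R 2 2 h δ ∧ HodgeConjectureFor A.dim A.X ∧
      weilClassesField A η (R.comp (X ^ 2)) (2 * 2) ≤ algebraicClasses A.X 2 := by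
  haveI : IsCMField (cmField R) := isCMField_cmField hroots
  haveI : IsGalois ℚ (cmField R) := isGalois_of_sq_add R hR t' h1
  obtain ⟨hRm, hRdeg⟩ := monic_and_natDegree_of_quadratic R hR
  exact carrier_exists_cmEightfold_hodgeConjectureFor_of_isCyclic R hRm hRdeg hroots
    (isCyclic_of_sq_add R hR t' h1 u hu h2) δ

/-- **Quartic carriers CONTAINING `ℚ(√-c)`: HC at a CM eightfold on EVERY row of the table.** For `R = S² + pS + q`
as above, an element `η' ∈ E` with `η'² + η² + p = 0` (so `E/ℚ` is Galois), `c > 0` and an element `i ∈ E` with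
`i² + c = 0` (so `ℚ(√-c) ⊂ E`, `Gal(E/ℚ) ≅ V₄`), and EVERY `δ ∈ cmNormResidueGroup R`: a CM eightfold (`B⁴`, `B ~ C₁²`
of the type induced from `ℚ(√-c)`) with a Weil-type `(2,2;2,2)` datum, a Rosati-compatible polarization class of
discriminant `δ`, the Hodge conjecture (kernel: Hazama / Pohlmann) and `W_E ⊗ ℂ` algebraic.
[cite: Gordon1999HodgeAVSurvey, Thm. 6.4] [cite: Deligne1982HodgeCycles, §5 (c) pp. 38–39] -/
theorem carrier_exists_cmEightfold_hodgeConjectureFor_of_sqrt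
    (hroots : ∀ s : ℂ, Polynomial.eval₂ (Int.castRingHom ℂ) s R = 0 → s.im = 0 ∧ s.re < 0)
    (t' : cmField R) (h1 : t' ^ 2 + cmRoot R ^ 2 + (p : cmField R) = 0)
    {c : ℤ} (hc : 0 < c) (i : cmField R) (hi : i ^ 2 + (c : cmField R) = 0) (δ : cmNormResidueGroup R) :
    ∃ (A : AbelianVariety ℂ) (η : A ⟶ A) (h : complexBetti A.X 2),
      A.dim = 8 ∧ IsOfCMType A ∧ IsWeilTypeCM A η R 2 2 ∧ IsPolarizationClass A.dim A.X h ∧ RosatiCompatible A η h ∧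
      HasWeilDiscriminantCM A η R 2 2 h δ ∧ HodgeConjectureFor A.dim A.X ∧
      weilClassesField A η (R.comp (X ^ 2)) (2 * 2) ≤ algebraicClasses A.X 2 := by
  haveI : IsCMField (cmField R) := isCMField_cmField hroots
  haveI : IsGalois ℚ (cmField R) := isGalois_of_sq_add R hR t' h1
  haveI := fact_irreducible_cmPolyQ_linear c hc
  haveI := fact_irreducible_realPolyQ_linear c
  haveI : IsCMField (cmField (X + C c)) := isCMField_cmField_linear c hc
  obtain ⟨ψ, -⟩ := exists_ringHom_cmField_linear c hc i hi
  letI : Algebra (cmField (X + C c)) (cmField R) := ψ.toAlgebra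
  obtain ⟨hRm, hRdeg⟩ := monic_and_natDegree_of_quadratic R hR
  exact carrier_exists_cmEightfold_hodgeConjectureFor_of_quadratic_subfield R hRm hRdeg hroots
    (K₁ := cmField (X + C c)) (finrank_cmField_linear c hc) δ

end Carrier

end Summit.HodgeConjecture.HodgeConjecture.Ring2.WeilCoverageCM

end
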